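import Summits.Ventures.HodgeRepro.Night1AndreGalois
import Summits.Ventures.HodgeRepro.Night1AndreDirectSum

/-!
# The Galois-stable wedge-spanned subspaces are the unions of orbits: the orbit decomposition of Theorem 1
is the finest Galois-rational one

Blind re-derivation cell `pub-hodge-repro`, seat `night-1` (gen 6).  Imports night-1's `Night1AndreGalois`
(the Galois action `galOn p g` on `⋀^{2p} ℂ^X`, `e_x ↦ e_{g • x}`) and `Night1AndreDirectSum` (the canonical
wedges `sizedWedge`, their independence, `orbitSets`, `orbitSpan`).  Namespace `HodgeRepro.RouteC`.

On the model the `ℚ`-rational subspaces of `H^{2p}(A) ⊗ ℂ` are (by Galois descent, printed — Deligne LNM 900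
§3) the Galois-stable ones.  Among the subspaces spanned by coordinate wedges `e_S`, `S ∈ F`, Galois stability
is a condition on the index set `F` alone:

* `smulSized g S` — the translate `g • S` of a `2p`-set; **`galOn_sizedWedge`** — `g` carries `e_S` to
  `± e_{g • S}` (two enumerations of `g • S`); **`map_galOn_span_sizedWedge_image`** — `g` carries the span of
  `{e_S : S ∈ F}` onto the span of `{e_S : S ∈ g • F}`;
* **`forall_map_galOn_le_iff`** — the span of `{e_S : S ∈ F}` is stable under every `galOn p g` IFF `F` is
  closed under the Galois action (⟸ by the image formula; ⟹ by linear independence: the wedge of a set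
  outside `F` is not in the span, `LinearIndependent.notMem_span_image`);
* **`eq_orbitSized_of_stable_of_subset`** — a Galois-closed non-empty subset of an orbit is the whole orbit: the
  orbit spans `orbitSpan (orbitSets Δ) = f_Δ^*(W_F(A_Δ)) ⊗ ℂ` are the MINIMAL Galois-stable wedge-spanned
  subspaces, so the direct sum of Theorem 1 (`jointEigenspaceOn_eq_iSup_orbitSpan`) is the finest
  Galois-rational decomposition of the Hodge classes by coordinate wedges.

Nothing geometric is built; the `ℚ`-structure itself is not modelled (only its Galois-stability avatar).
Nothing here says anything about the status of the Hodge conjecture for CM abelian varieties, which is NOT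
proved.
-/

set_option autoImplicit false

open Finset Module
open scoped Pointwise

namespace HodgeRepro.RouteC

open CMHodgeOn

section Stable

variable {G : Type*} [Group G] [DecidableEq G] [Fintype G] {X : Type*} [MulAction G X] [Fintype X]
  [DecidableEq X]

omit [DecidableEq G] [Fintype G] [Fintype X] in
/-- `g` carries a coordinate wedge to the coordinate wedge of the translated family. -/
theorem galOn_coordWedgeOn {p : ℕ} (g : G) (s : Fin (2 * p) → X) :
    galOn p g (coordWedgeOn (2 * p) s) = coordWedgeOn (2 * p) fun j => g • s j := by
  unfold galOn coordWedgeOn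
  rw [exteriorPower.map_apply_ιMulti]
  congr 1
  funext j
  rw [Function.comp_apply, galOnLin_coordVecOn]

omit [DecidableEq G] [Fintype G] [Fintype X] in
/-- The translate of a `2p`-set is a `2p`-set. -/
theorem card_smul_eq {n : ℕ} (g : G) (S : Finset X) (h : S.card = n) : (g • S).card = n := by
  rw [card_smul_finset, h]

omit [DecidableEq G] [Fintype G] [Fintype X] in
/-- The Galois action on `n`-sets. -/
def smulSized {n : ℕ} (g : G) (S : SizedSets X n) : SizedSets X n := ⟨g • S.1, card_smul_eq g S.1 S.2⟩

omit [DecidableEq G] [Fintype G] [Fintype X] in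
/-- The translated canonical enumeration enumerates the translate. -/
theorem image_smul_setEnum {n : ℕ} (g : G) (S : SizedSets X n) :
    univ.image (fun j => g • setEnum S.1 S.2 j) = g • S.1 := by
  ext x
  simp only [mem_image, mem_univ, true_and, mem_smul_finset]
  constructor
  · rintro ⟨j, rfl⟩
    exact ⟨setEnum S.1 S.2 j, ((Finset.equivFinOfCardEq S.2).symm j).2, rfl⟩
  · rintro ⟨y, hy, rfl⟩
    exact ⟨Finset.equivFinOfCardEq S.2 ⟨y, hy⟩, by simp only [setEnum, Equiv.symm_apply_apply]⟩

omit [DecidableEq G] [Fintype G] [Fintype X] in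
/-- **`g` carries `e_S` to `± e_{g • S}`** (the sign of the permutation between the two enumerations of `g • S`). -/
theorem galOn_sizedWedge {p : ℕ} (g : G) (S : SizedSets X (2 * p)) :
    ∃ π : Equiv.Perm (Fin (2 * p)),
      galOn p g (sizedWedge S) = ((Equiv.Perm.sign π : ℤ) : ℂ) • sizedWedge (smulSized g S) := by
  unfold sizedWedge
  rw [galOn_coordWedgeOn]
  have hinj : Function.Injective fun j => g • setEnum S.1 S.2 j :=
    fun a b h => setEnum_injective S.1 S.2 (smul_left_cancel g h)
  exact coordWedgeOn_eq_sign_smul_of_image_eq (setEnum_injective (smulSized g S).1 (smulSized g S).2)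
    hinj (by rw [image_setEnum, image_smul_setEnum]; rfl)

/-- The sign, as a complex number, is non-zero. -/
theorem sign_cast_ne_zero {n : ℕ} (π : Equiv.Perm (Fin n)) : ((Equiv.Perm.sign π : ℤ) : ℂ) ≠ 0 :=
  Int.cast_ne_zero.2 (Units.ne_zero _)

omit [DecidableEq G] [Fintype G] [Fintype X] in
/-- **`g` carries the span of the wedges of `F` onto the span of the wedges of `g • F`.** -/
theorem map_galOn_span_sizedWedge_image {p : ℕ} (g : G) (F : Set (SizedSets X (2 * p))) :
    (Submodule.span ℂ (sizedWedge '' F)).map (galOn p g) =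
      Submodule.span ℂ (sizedWedge '' (smulSized g '' F)) := by
  rw [Submodule.map_span]
  refine le_antisymm (Submodule.span_le.2 ?_) (Submodule.span_le.2 ?_)
  · rintro _ ⟨_, ⟨S, hS, rfl⟩, rfl⟩
    obtain ⟨π, hπ⟩ := galOn_sizedWedge g S
    rw [SetLike.mem_coe, hπ]
    exact (Submodule.span ℂ _).smul_mem _
      (Submodule.subset_span (Set.mem_image_of_mem _ (Set.mem_image_of_mem _ hS)))
  · rintro _ ⟨_, ⟨S, hS, rfl⟩, rfl⟩
    obtain ⟨π, hπ⟩ := galOn_sizedWedge g S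
    have key : galOn p g (((Equiv.Perm.sign π : ℤ) : ℂ)⁻¹ • sizedWedge S) = sizedWedge (smulSized g S) := by
      rw [map_smul, hπ, smul_smul, inv_mul_cancel₀ (sign_cast_ne_zero π), one_smul]
    rw [SetLike.mem_coe, ← key, map_smul]
    exact (Submodule.span ℂ _).smul_mem _ (Submodule.subset_span
      (Set.mem_image_of_mem (galOn p g) (Set.mem_image_of_mem sizedWedge hS)))

omit [DecidableEq G] [Fintype G] [Fintype X] in
/-- **Galois stability of a wedge-spanned subspace is closure of its index set**: the span of `{e_S : S ∈ F}`
is stable under every `galOn p g` iff `F` is closed under the Galois action on `2p`-sets. -/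
theorem forall_map_galOn_le_iff {p : ℕ} (F : Set (SizedSets X (2 * p))) :
    (∀ g : G, (Submodule.span ℂ (sizedWedge '' F)).map (galOn p g) ≤ Submodule.span ℂ (sizedWedge '' F)) ↔
      ∀ (g : G), ∀ S ∈ F, smulSized g S ∈ F := by
  constructor
  · intro h g S hS
    by_contra hgS
    have hmem : sizedWedge (smulSized g S) ∈ Submodule.span ℂ (sizedWedge '' F) := by
      refine h g ?_
      rw [map_galOn_span_sizedWedge_image]
      exact Submodule.subset_span (Set.mem_image_of_mem _ (Set.mem_image_of_mem _ hS))
    exact (linearIndependent_sizedWedge (2 * p)).notMem_span_image hgS hmem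
  · intro h g
    rw [map_galOn_span_sizedWedge_image]
    refine Submodule.span_mono (Set.image_mono ?_)
    rintro _ ⟨S, hS, rfl⟩
    exact h g S hS

omit [DecidableEq G] [Fintype X] in
/-- **A Galois-closed non-empty subset of an orbit is the whole orbit**: the orbit pieces of Theorem 1 are the
minimal Galois-stable wedge-spanned subspaces. -/
theorem eq_orbitSized_of_stable_of_subset {p : ℕ} {Δ : Finset X} {F : Set (SizedSets X (2 * p))}
    (hF : F ⊆ orbitSized (G := G) (2 * p) Δ) (hne : F.Nonempty)
    (hstable : ∀ (g : G), ∀ S ∈ F, smulSized g S ∈ F) : F = orbitSized (G := G) (2 * p) Δ := by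
  refine Set.Subset.antisymm hF fun T hT => ?_
  obtain ⟨S, hS⟩ := hne
  obtain ⟨σ, hσ⟩ := mem_orbitSets.1 (hF hS)
  obtain ⟨τ, hτ⟩ := mem_orbitSets.1 hT
  have : smulSized (τ * σ⁻¹) S = T := by
    apply Subtype.ext
    show (τ * σ⁻¹) • S.1 = T.1
    rw [mul_smul, ← hσ, inv_smul_smul, hτ]
  rw [← this]
  exact hstable _ S hS

omit [DecidableEq G] [Fintype X] in
/-- The orbit spans are Galois-stable (the orbit is Galois-closed). -/
theorem map_galOn_span_orbitSized_le {p : ℕ} (Δ : Finset X) (g : G) :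
    (Submodule.span ℂ (sizedWedge '' orbitSized (G := G) (2 * p) Δ)).map (galOn p g) ≤
      Submodule.span ℂ (sizedWedge '' orbitSized (G := G) (2 * p) Δ) := by
  refine (forall_map_galOn_le_iff _).2 (fun g S hS => ?_) g
  rw [mem_orbitSized] at hS ⊢
  obtain ⟨σ, hσ⟩ := mem_orbitSets.1 hS
  exact mem_orbitSets.2 ⟨g * σ, by rw [mul_smul, hσ]; rfl⟩

end Stable

end HodgeRepro.RouteC
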